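import Literature.Claims.NS.ClayVariants
import Literature.Analysis.FluidPDE.SuitableWeak
import Literature.Analysis.FluidPDE.LocalTypeI
import Literature.Analysis.FluidPDE.LerayHopf
import Literature.Analysis.FluidPDE.BoundedLerayHopfClay
import Literature.Analysis.FluidPDE.LeraySuitableWeakSolutions
import Mathlib.MeasureTheory.Integral.IntervalIntegral.Basic
import HarnessLib

/-!
# Claims/NS — Schatz 2025, «Anchored Collar Mechanisms for 3D Navier–Stokes: Dirichlet–to–Neumann Law, Flux
Absorption, Dissipation Balance, Contraction to Global Smoothness» (C171, D-0090 NS-CLAIMS SWEEP)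

TEXT OF RECORD: Zenodo record 17082278 (concept 17082277, SINGLE version, created 2025-09-09), PDF sha16
80a1781f8c061ace, 72 pp., PDF page = printed page (census pin `census/texts/Schatz2025/`); bib `Schatz2025`.
Author line as printed p.1 l.4–6. Setting p.1 l.23–33: `ℝ³`, `ν = 1` («∂tu − ∆u + (u · ∇)u + ∇p = 0, ∇· u = 0»),
unforced, datum `u0 ∈ L²(ℝ³)` divergence free; «A Leray–Hopf (suitable) solution satisfies the global energy
inequality and the local energy inequality (LEI)» (p.1 l.31–32) — the text prints NO Definition environment for
the class (LOCATORS v2 §1 p.56 row); App. S Lemma S.1 p.56 l.6–22 states the LEI for «a suitable weak solution of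
Navier–Stokes on an open set D ⊂ R³ × R». TYPED CLASS (`IsSolution`): the tree's Leray–Hopf class
`IsLerayHopfOn T 1 0 u0 u` (global energy inequality, datum attained) AND the tree's CKN class
`IsSuitableWeakSolutionOn` on the open slab `(0,T) × ℝ³` with an explicit pressure `p` (the LEI of Lemma S.1),
datum `u0 ∈ L²` weakly divergence free. Nothing is added (no smallness, no normalisation, hazard (h1)).

CLAIMED STATEMENT = Theorem 2.1 p.3 l.2–17 «(Global regularity and uniqueness). Let u0 ∈ L²(R³) be
divergence–free, and let (u, p) be a Leray–Hopf (suitable) solution to the three–dimensional Navier–Stokes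
equations on [0, T]. Then u is smooth on R³ × (0, T] and unique among Leray–Hopf solutions. In particular, for
every T > 0 and τ > 0, u ∈ C∞(R³ × (0, T]) ∩ L∞((τ, T]; H^k(R³)) for all k ∈ N.» TWO faces:
`ClaimedTheorem` = the REGULARITY face (typed on the OPEN slab `(0,T) × ℝ³`: «u is a.e. equal to a function
jointly C^∞ on (0,T) × ℝ³»; the closed end `t = T` and the `L∞((τ,T];H^k)` clause are RECORDED, not typed —
weaker = charitable for a regularity claim, and exactly what the (A)-link consumes) and `ClaimedUniqueness` = the
UNIQUENESS face (RECORDED; hazard (h2): no kernel object on Leray–Hopf (non-)uniqueness from `L²` data is in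
the tree). The head lettering runs on the regularity chain.

PRINTED CHAIN (p.3 l.18–39 «Proof.» Stages 1–5; §3 p.4; Thm R.5 p.54 l.1–13 is where the chain is executed):
Stages 1–3 (Apps D, H, I, J, K, L, S.7, Thm S.13 AC2–TI p.60) ⇒ Stage 4 Lemma M.1 / (M.1) p.42 (fixed-ratio
contraction of the CKN triple `F = A + B + P`) ⇒ Lemma N.1 RHT p.44 / Prop O.2 Gehring p.47 ⇒ Stage 5: Thm R.5
proof p.54 l.11–13 «By (Gε) and RHT, for each z0 = (x0, t0) with t0 ∈ [τ, T] there exists r > 0 with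
F(z0, r) ≤ εCKN. Then ε–regularity yields smoothness on Q_{r/2}(z0). A Vitali subcover gives smoothness on the
entire slab.» (Thm P.1 p.48, Lemma Q.1 p.50) ⇒ Thm 2.1 regularity; uniqueness p.54 l.14– via Prop R.4.

TYPING NOTES. (1) Space–time points are `z = (t, x) : ℝ × E3`, TIME FIRST, and `Q_r(z) = (t − r², t) × B_r(x)`
is the tree's OPEN backward cylinder `parabolicCylinder`; the print's `Q_ρ(z0) = B_ρ(x0) × (t0 − ρ², t0]`
(p.48 l.3) differs by the null top slice (and `A`'s `sup` over `t ≤ t0` vs `t < t0`) — recorded. (2) The CKN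
triple is the tree's: `A = cknA` (genuine `sup`), `B = cknC`, `P = cknDOsc` (mean-free pressure, exactly the
print's `|p − (p)_{Bρ}(t)|^{3/2}`), all in `[0, ∞]` (honest carrier: no Bochner junk); (M.1) is typed in `ℝ≥0∞`
as `F(θr) ≤ ofReal κ · F(r) + ofReal (C θ³)`. (3) (M.1) is typed in its printed quantifier order (h3): `θ` is an
existential of Lemma M.1 together with `κ, C` («There exist universal constants θ ∈ (0, 1/8), κ ∈ (0, 1) and
C < ∞ such that (M.1) holds», p.42 l.39–40), BEFORE the solution, the point and the radius; the p.3 l.41 face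
«for all z0 and 0 < r ≤ 1» over the solutions of Thm 2.1 with `Q_{2r}(z0)` inside the slab (p.42 l.2) is the
CONSUMED binder `Step_M1`; the p.42 l.38 LOCAL face «for every suitable weak solution on Q_r(z0)» (any open
region carrying `Q_{2r}(z0)`, no `r ≤ 1`) is RECORDED as `Step_M1_local` (stronger; implies `Step_M1`, PROVED).
(4) STAGE-3 INPUT OF APP. M: p.3 l.28–31 names Thm S.13 (AC2–TI) as the input «giving» the contraction, but the
proof of Lemma M.1 (p.42 l.41 – p.43 l.25; Remark M.3 p.43 l.32–36 «Where each input is used») consumes the ring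
step through ONE display, (M.4) p.42 l.78–83 «D(θ) ≤ C θ[A(1) + B(1)] + C θ³» (Lemma I.4 + Lemma U.3 / Prop U.4 +
App. L), and does not cite Thm S.13; Thm R.5's proof does not cite it either. So the Stage-3 output is typed AT
THE GRAIN APP. M PRINTS IT, `Step_M4` ((M.4), un-normalised by the NS scaling of Step 1 p.42 l.41: `D` picks up
`r⁻¹`, `A`, `B` are scale invariant), and App. M Steps 4–7 ((M.5)–(M.9), LEI bookkeeping + «choose θ small
enough» + `κ := Cθ + 2ε`) are the binder `Step_Mbook : Step_M4 → Step_M1`. Thm S.13 (S.10) p.60 l.16–19 — a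
Littlewood–Paley dyadic-tail inequality `S_{J+w}[Iθ] ≤ θcap S_J[Iθ] + Cθ³` — is RECORDED here by locator only
(the tree has no Littlewood–Paley blocks on `ℝ³` in this vocabulary; it is not on the typed path of R.5).
(5) THE SMALLNESS ENTRANCE (h4): Thm R.5 l.11–12 passes from (Gε)+RHT to «there exists r > 0 with
F(z0, r) ≤ εCKN» with `εCKN` the threshold of Thm P.1; iterating (M.1) gives only
`limsup_k F(z0, θ^k r) ≤ Cθ³/(1 − κ)`, and no line compares `Cθ³/(1 − κ)` with `εCKN`. This passage is typed as
its own binder `Step_R5a` (any admissible contraction constants + any RHT constants + any threshold at which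
ε-regularity holds ⇒ every slab point is covered by a half-cylinder on whose double `F ≤ ε`); in the tree's
open-cylinder vocabulary «z0 is covered by Q_{r/2}(z0)» (top slice included in print) is rendered «z lies in
`Q_{r/2}(z')` for some centre `z'` with `Q_r(z') ⊆` slab» — recorded. (6) `Step_P1` = Thm P.1's smoothness
conclusion («u is smooth on Q_{ρ/2}(z0)»: a.e. equal to a `C^∞` function on the open half cylinder); the
gradient bound `sup |u| + ρ sup |∇u| ≤ C ρ⁻¹ F^{1/3}` is RECORDED (not consumed by R.5). TRUE-type candidate
(CKN Prop. 1 / Lin 1998 in the `A + B + P` form; tree `oneScaleRegularity` is the `C + D`, `L^∞` form).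
(7) `Step_Q` = Lemma Q.1 + R.5 l.12–13 AS USED: local smooth representatives on an open cover of the slab by
cylinders glue to a smooth representative on the slab. TRUE-type (sheaf gluing; not attempted at TYPED).
(8) `Step_N1` = Lemma N.1 (N.1) p.44 l.13–22 verbatim (`∃ β ∈ (0,1), C` before the solution; `0 < r ≤ 1`).
(9) Uniqueness: Thm R.5 l.14–20 derives it from the smoothness via Prop R.4 — typed as the implication binder
`Step_R5u : ClaimedTheorem → ClaimedUniqueness` (records; h2).

CLAY (A) LINK — PROVED, no bridge hypothesis: `clayA_of_claimed : ClaimedTheorem → ClayVariants.clayR3.Regularity`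
through the tree doors `exists_isGlobalLerayHopf_and_isLocalEnergySolutionOn` (Leray's solution from a Clay datum is
Leray–Hopf AND suitable on every slab — CKN 1982 Appendix, PROVED in the tree), `ClaimedTheorem` (smooth for
`t > 0` ⇒ essentially bounded on a cylinder below every `(T, x)`, `T > 0`),
`clay_solution_of_locallyBounded_globalLerayHopf` (the `t = 0` layer and (7)), and `clayR3_regularityAt_iff`
(`ν = 1` ⇒ every `ν`). Δ-axes (CARD §3): data `L²` ⊋ (4) (WIDER); statement ABOUT every suitable Leray–Hopf
solution vs (A)'s existence of one smooth solution; conclusion open at `t = 0` as printed; uniqueness beyond (A).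

WHAT THIS IS NOT: not a claim about NS regularity or blow-up; not a claim about any author beyond the typed locator.
-/

noncomputable section

open Set Function Filter MeasureTheory Metric
open scoped Topology ENNReal NNReal ContDiff InnerProductSpace RealInnerProductSpace

namespace Literature.Claims.NS.Schatz2025

open Literature.Analysis.FluidPDE

/-- Physical space `ℝ³` (p.1 l.23–31). [cite: Schatz2025, §1 p.1 l.23–31] -/
abbrev E3 : Type := EuclideanSpace ℝ (Fin 3)

/-! ### The class (p.1 l.31–32, p.3 l.2–8, App. S Lemma S.1 p.56 l.6–22) and the CKN triple (Table 3.3 p.5; p.42 l.4–35) -/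

/-- The open slab `(0,T) × ℝ³` (the tree's `slab`), on which the LEI of Lemma S.1 p.56 is imposed («on [0, T]»,
p.3 l.8; typed open). [cite: Schatz2025, Thm 2.1 p.3 l.2–8] -/
def slabT (T : ℝ) : TopologicalSpace.Opens (ℝ × E3) := slab E3 (Ioo 0 T) isOpen_Ioo

/-- **The solution class of Theorem 2.1** («Let u0 ∈ L²(R³) be divergence–free, and let (u, p) be a Leray–Hopf
(suitable) solution … on [0, T]», p.3 l.2–8; «A Leray–Hopf (suitable) solution satisfies the global energy
inequality and the local energy inequality (LEI)», p.1 l.31–32; LEI = Lemma S.1 (S.1) p.56 l.6–22), `ν = 1`,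
unforced: datum in `L²` and weakly divergence free, `u` Leray–Hopf from `u0` on `[0,T)` (tree `IsLerayHopfOn`),
and `(u, p)` a CKN suitable weak solution on the open slab (tree `IsSuitableWeakSolutionOn`).
[cite: Schatz2025, Thm 2.1 p.3 l.2–8; §1 p.1 l.31–32; Lemma S.1 p.56 l.6–22] -/
structure IsSolution (T : ℝ) (u₀ : E3 → E3) (u : ℝ → E3 → E3) (p : ℝ → E3 → ℝ) : Prop where
  /-- `u0 ∈ L²(ℝ³)` (p.3 l.2). -/
  datum_memLp : MemLp u₀ 2 volume
  /-- `div u0 = 0` weakly (p.3 l.6). -/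
  datum_divFree : IsWeaklyDivFree u₀
  /-- Leray–Hopf on `[0,T)` from `u0`, `ν = 1`, `f = 0` (p.3 l.7; p.1 l.31 «global energy inequality»). -/
  lerayHopf : IsLerayHopfOn T 1 0 u₀ u
  /-- «(suitable)»: the local energy inequality class on the open slab (p.1 l.32; Lemma S.1 p.56). -/
  suitable : IsSuitableWeakSolutionOn (slabT T) 1 0 u p

/-- **The CKN triple `F(z0, ρ) = A + B + P`** (Table 3.3 p.5; p.42 l.4–35; p.48 l.2–6):
`A(ρ) = ρ⁻¹ sup_{t0−ρ²<t≤t0} ∫_{Bρ(x0)} |u|²`, `B(ρ) = ρ⁻² ∫_{Qρ} |u|³`, `P(ρ) = ρ⁻² ∫_{Qρ} |p − (p)_{Bρ}(t)|^{3/2}`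
— the tree's `cknA + cknC + cknDOsc` at centre `z = (t0, x0)` (time first), in `[0, ∞]`.
[cite: Schatz2025, Table 3.3 p.5; App. M p.42 l.4–35] -/
def Ffun (r : ℝ) (z : ℝ × E3) (u : ℝ → E3 → E3) (p : ℝ → E3 → ℝ) : ℝ≥0∞ :=
  cknA r z u + cknC r z u + cknDOsc r z p

/-- The (non-scale-invariant) dissipation `D(ρ) := ∫_{Qρ} |∇u|²` (p.42 l.50–55), through a weak spatial gradient
`G` of `u`. [cite: Schatz2025, App. M p.42 l.50–55] -/
def Dfun (r : ℝ) (z : ℝ × E3) (G : ℝ → E3 → E3 →L[ℝ] E3) : ℝ≥0∞ :=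
  ∫⁻ q in parabolicCylinder r z, ENNReal.ofReal (frobeniusNormSq (G q.1 q.2))

/-- Admissible cylinders of the p.3 face: `0 < r ≤ 1` (p.3 l.41) and `Q_{2r}(z0)` inside the open slab (p.42 l.2
«fix a center z0 = (x0, t0) and a radius 0 < r ≤ 1 such that Q2r(z0) ⊂ R³ × R», read for the solution of
Thm 2.1 as: inside its domain). [cite: Schatz2025, p.3 l.41; App. M p.42 l.2] -/
def AdmCyl (T r : ℝ) (z : ℝ × E3) : Prop :=
  0 < r ∧ r ≤ 1 ∧ parabolicCylinder (2 * r) z ⊆ (slabT T : Set (ℝ × E3))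

/-! ### The claimed statement (two faces) -/

/-- **Theorem 2.1, REGULARITY face** (p.3 l.2–9 «Then u is smooth on R³ × (0, T]»), typed on the open slab:
every solution of the class is a.e. equal on `(0,T) × ℝ³` to a jointly `C^∞` function. (Closed end `t = T` and
«u ∈ L∞((τ, T]; H^k(R³)) for all k» p.3 l.10–17 RECORDED, not typed.)
[claim: Schatz2025, status: disputed] [cite: Schatz2025, Thm 2.1 p.3 l.2–17] -/
def ClaimedTheorem : Prop :=
  ∀ T : ℝ, 0 < T → ∀ (u₀ : E3 → E3) (u : ℝ → E3 → E3) (p : ℝ → E3 → ℝ), IsSolution T u₀ u p →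
    ∃ w : ℝ → E3 → E3, (∀ᵐ z ∂(volume.restrict (slabT T : Set (ℝ × E3))), w z.1 z.2 = u z.1 z.2) ∧
      IsSmoothSpaceTimeOn (Ioo 0 T) w

/-- **Theorem 2.1, UNIQUENESS face** (p.3 l.9 «and unique among Leray–Hopf solutions»; Thm R.5 p.54 l.4–5 «if
(v, π) is another Leray–Hopf solution with the same data, then u ≡ v on [0, T]»): RECORDED face (hazard h2).
[claim: Schatz2025, status: disputed] [cite: Schatz2025, Thm 2.1 p.3 l.9; Thm R.5 p.54 l.4–5] -/
def ClaimedUniqueness : Prop :=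
  ∀ T : ℝ, 0 < T → ∀ (u₀ : E3 → E3) (u : ℝ → E3 → E3) (p : ℝ → E3 → ℝ) (v : ℝ → E3 → E3),
    IsSolution T u₀ u p → IsLerayHopfOn T 1 0 u₀ v →
      ∀ᵐ z ∂(volume.restrict (slabT T : Set (ℝ × E3))), u z.1 z.2 = v z.1 z.2

/-! ### Stage 4 — App. M p.42–43: the fixed-ratio contraction (Gε) and its Stage-3 input (M.4) -/

/-- The contraction (M.1) with constants `(θ, κ, C)` over the class of Thm 2.1, p.3 face: for every solution,
every centre and every admissible radius, `F(z0, θr) ≤ κ F(z0, r) + C θ³` (p.3 l.40–42; (M.1) p.42 l.37–38), in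
`[0, ∞]`. [cite: Schatz2025, p.3 l.40–42; (M.1) p.42 l.36–38] -/
def ContractsWith (θ κ C : ℝ) : Prop :=
  ∀ (T : ℝ) (u₀ : E3 → E3) (u : ℝ → E3 → E3) (p : ℝ → E3 → ℝ), IsSolution T u₀ u p →
    ∀ (z : ℝ × E3) (r : ℝ), AdmCyl T r z →
      Ffun (θ * r) z u p ≤ ENNReal.ofReal κ * Ffun r z u p + ENNReal.ofReal (C * θ ^ 3)

/-- **Lemma M.1 (Gε contraction)** p.42 l.39–40 «There exist universal constants θ ∈ (0, 1/8), κ ∈ (0, 1) and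
C < ∞ such that (M.1) holds» = p.3 l.40–42 «Quantitative consequences. There exist universal θ ∈ (0, 1/8),
κ ∈ (0, 1), C < ∞ … such that for all z0 and 0 < r ≤ 1, F(z0, θr) ≤ κ F(z0, r) + C θ³» — CONSUMED binder
(quantifier order as printed: constants first). [claim: Schatz2025, status: disputed]
[cite: Schatz2025, Lemma M.1 p.42 l.36–40; p.3 l.40–42] -/
def Step_M1 : Prop :=
  ∃ θ κ C : ℝ, 0 < θ ∧ θ < 1 / 8 ∧ 0 < κ ∧ κ < 1 ∧ 0 ≤ C ∧ ContractsWith θ κ C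

/-- **(M.1) LOCAL face, as displayed p.42 l.37–38** «F(θr) ≤ κ F(r) + C θ³ for every suitable weak solution on
Qr(z0)» (any open region `Q` carrying `Q_{2r}(z0)`, cf. l.2 and Step 2's test function on `Q2`; no `r ≤ 1`):
RECORDED face, stronger than `Step_M1` (`step_M1_of_local`). [claim: Schatz2025, status: disputed]
[cite: Schatz2025, (M.1) p.42 l.2, l.36–38] -/
def Step_M1_local : Prop :=
  ∃ θ κ C : ℝ, 0 < θ ∧ θ < 1 / 8 ∧ 0 < κ ∧ κ < 1 ∧ 0 ≤ C ∧
    ∀ (Q : TopologicalSpace.Opens (ℝ × E3)) (u : ℝ → E3 → E3) (p : ℝ → E3 → ℝ),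
      IsSuitableWeakSolutionOn Q 1 0 u p → ∀ (z : ℝ × E3) (r : ℝ), 0 < r →
        parabolicCylinder (2 * r) z ⊆ (Q : Set (ℝ × E3)) →
          Ffun (θ * r) z u p ≤ ENNReal.ofReal κ * Ffun r z u p + ENNReal.ofReal (C * θ ^ 3)

/-- The content of (M.4) with constants `(θ, C)`, un-normalised (Step 1 p.42 l.41 «By scaling and translation we
may assume r = 1, z0 = (0, 0)»; under `u ↦ r u(x0 + r·, t0 + r²·)` the dissipation `D(θ)` becomes
`r⁻¹ D(θr; z0)` and `A(1), B(1)` become `A(z0, r), B(z0, r)`): «small interior dissipation»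
`r⁻¹ ∫_{Q_{θr}(z0)} |∇u|² ≤ C θ [A(z0, r) + B(z0, r)] + C θ³`, `∇u` = any weak spatial gradient of `u` on the
slab. [cite: Schatz2025, (M.4) p.42 l.78–83; Step 1 p.42 l.41–49] -/
def SmallDissipWith (θ C : ℝ) : Prop :=
  ∀ (T : ℝ) (u₀ : E3 → E3) (u : ℝ → E3 → E3) (p : ℝ → E3 → ℝ) (G : ℝ → E3 → E3 →L[ℝ] E3),
    IsSolution T u₀ u p → HasWeakSpatialGradientOn (slabT T) u G →
      ∀ (z : ℝ × E3) (r : ℝ), AdmCyl T r z →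
        (ENNReal.ofReal r)⁻¹ * Dfun (θ * r) z G ≤
          ENNReal.ofReal (C * θ) * (cknA r z u + cknC r z u) + ENNReal.ofReal (C * θ ^ 3)

/-- **(M.4) «Step 3: Ring step ⇒ small interior dissipation on Qθ»** p.42 l.78–83: «the band–limit–free ring
bound with explicit leakage (Lemma I.4) and the leakage bookkeeping (Lemma U.3 and Proposition U.4) yield, for
the fixed θ ∈ (0, 1/8), D(θ) ≤ C θ[A(1) + B(1)] + C θ³. (M.4)» with `C` «geometry–only» (l.37) — the Stage-3
output AT THE GRAIN APP. M CONSUMES IT (Remark M.3 p.43 l.32–36); `θ` is «Fix a geometric ratio θ ∈ (0, 1/8)»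
(l.36), so typed `∀ θ ∈ (0, 1/8) ∃ C` (literal; `C` may depend on the geometry parameter `θ`, Table 3.1 p.5).
CONSUMED binder of the fine composition. [claim: Schatz2025, status: disputed]
[cite: Schatz2025, (M.4) p.42 l.78–83; Remark M.3 p.43 l.32–36] -/
def Step_M4 : Prop :=
  ∀ θ : ℝ, 0 < θ → θ < 1 / 8 → ∃ C : ℝ, 0 ≤ C ∧ SmallDissipWith θ C

/-- **App. M Steps 4–7** ((M.5)–(M.9) p.42 l.84 – p.43 l.25: LEI control of `A(θ)`, Gagliardo–Nirenberg control
of `B(θ)` «for a universal ε ∈ (0, 1) (choose θ small enough)», pressure control of `P(θ)` «reducing θ universally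
once more», «κ := Cθ + 2ε ∈ (0, 1) for θ and ε chosen universally») AS THE IMPLICATION THEY ASSERT: (M.4) ⇒
Lemma M.1. Bookkeeping binder of the fine composition. [claim: Schatz2025, status: disputed]
[cite: Schatz2025, App. M Steps 4–7 p.42 l.84 – p.43 l.25] -/
def Step_Mbook : Prop := Step_M4 → Step_M1

/-! ### Lemma N.1 p.44 — reverse Hölder in time (RHT) -/

/-- The content of (N.1) with constants `(β, C)`: `∫_{Q_r(z0)} |∇u|² ≤ β ∫_{Q_{2r}(z0)} |∇u|² + C r³` for every
solution, centre and admissible radius. [cite: Schatz2025, (N.1) p.44 l.13–22] -/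
def RHTWith (β C : ℝ) : Prop :=
  ∀ (T : ℝ) (u₀ : E3 → E3) (u : ℝ → E3 → E3) (p : ℝ → E3 → ℝ) (G : ℝ → E3 → E3 →L[ℝ] E3),
    IsSolution T u₀ u p → HasWeakSpatialGradientOn (slabT T) u G →
      ∀ (z : ℝ × E3) (r : ℝ), AdmCyl T r z →
        Dfun r z G ≤ ENNReal.ofReal β * Dfun (2 * r) z G + ENNReal.ofReal (C * r ^ 3)

/-- **Lemma N.1 (RHT: reverse–Hölder in time)** p.44 l.13–22 «There exist constants 0 < β < 1 and C < ∞ such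
that for every z0 = (x0, t0) and every 0 < r ≤ 1, ∫_{t0−r²}^{t0} ∫_{Br(x0)} |∇u|² ≤ β ∫_{t0−(2r)²}^{t0} ∫_{B2r(x0)}
|∇u|² + C r³» («All constants below are universal (geometry–only, independent of θ, r, or the solution)»
l.12) = p.3 l.43–52. CONSUMED binder («By (Gε) and RHT», p.54 l.11). [claim: Schatz2025, status: disputed]
[cite: Schatz2025, Lemma N.1 p.44 l.12–22; p.3 l.43–52] -/
def Step_N1 : Prop :=
  ∃ β C : ℝ, 0 < β ∧ β < 1 ∧ 0 ≤ C ∧ RHTWith β C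

/-! ### Stage 5 — Thm P.1 p.48 (ε-regularity), Thm R.5 p.54 l.11–13 (smallness + cover), Lemma Q.1 p.50 (Vitali) -/

/-- «u is smooth on Q_r(z)» (p.48 l.9): `u` is a.e. equal on the open cylinder to a function jointly `C^∞` there.
[cite: Schatz2025, Thm P.1 p.48 l.7–9] -/
def SmoothOnCyl (u : ℝ → E3 → E3) (r : ℝ) (z : ℝ × E3) : Prop :=
  ∃ w : ℝ → E3 → E3, ContDiffOn ℝ ∞ (uncurry w) (parabolicCylinder r z) ∧
    ∀ᵐ q ∂(volume.restrict (parabolicCylinder r z)), w q.1 q.2 = u q.1 q.2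

/-- ε-regularity at threshold `ε` over the class (the part of Thm P.1 that Thm R.5 consumes): `F(z0, ρ) ≤ ε` on a
cylinder inside the slab ⇒ `u` smooth on `Q_{ρ/2}(z0)`. [cite: Schatz2025, Thm P.1 p.48 l.7–9] -/
def EpsRegWith (ε : ℝ) : Prop :=
  ∀ (T : ℝ) (u₀ : E3 → E3) (u : ℝ → E3 → E3) (p : ℝ → E3 → ℝ), IsSolution T u₀ u p →
    ∀ (z : ℝ × E3) (ρ : ℝ), 0 < ρ → parabolicCylinder ρ z ⊆ (slabT T : Set (ℝ × E3)) →
      Ffun ρ z u p ≤ ENNReal.ofReal ε → SmoothOnCyl u (ρ / 2) z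

/-- **Theorem P.1 (ε–regularity)** p.48 l.7–19 «There exist universal constants εCKN > 0 and C < ∞ such that if
F(z0, ρ) ≤ εCKN, then u is smooth on Qρ/2(z0) and sup_{Qρ/2(z0)} |u| + ρ sup_{Qρ/2(z0)} |∇u| ≤ C ρ⁻¹ F(z0, ρ)^{1/3}»
— smoothness conclusion typed (the quantitative bound RECORDED). CONSUMED binder; TRUE-type candidate
(Caffarelli–Kohn–Nirenberg 1982 Prop. 1 / Lin 1998 in the `A + B + P` form). [claim: Schatz2025, status: disputed]
[cite: Schatz2025, Thm P.1 p.48 l.7–19] -/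
def Step_P1 : Prop :=
  ∃ ε : ℝ, 0 < ε ∧ EpsRegWith ε

/-- «for each z0 … there exists r > 0 with F(z0, r) ≤ εCKN» (p.54 l.11–12) in the open-cylinder vocabulary: every
point of the open slab lies in a half cylinder `Q_{r/2}(z')` whose double lies in the slab and carries
`F(z', r) ≤ ε`. [cite: Schatz2025, Thm R.5 proof p.54 l.11–13] -/
def CoveredBySmall (ε : ℝ) : Prop :=
  ∀ (T : ℝ) (u₀ : E3 → E3) (u : ℝ → E3 → E3) (p : ℝ → E3 → ℝ), IsSolution T u₀ u p →
    ∀ z ∈ (slabT T : Set (ℝ × E3)), ∃ (z' : ℝ × E3) (r : ℝ), 0 < r ∧ z ∈ parabolicCylinder (r / 2) z' ∧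
      parabolicCylinder r z' ⊆ (slabT T : Set (ℝ × E3)) ∧ Ffun r z' u p ≤ ENNReal.ofReal ε

/-- **Thm R.5 proof, first sentence** p.54 l.11–12 «By (Gε) and RHT, for each z0 = (x0, t0) with t0 ∈ [τ, T]
there exists r > 0 with F(z0, r) ≤ εCKN» — THE SMALLNESS ENTRANCE, typed as the implication it asserts: any
admissible contraction constants (Gε) and RHT constants, and any threshold `ε > 0` at which ε-regularity (Thm P.1)
holds, give the small-`F` cover. (Iterating (M.1) yields only `limsup_k F(z0, θ^k r) ≤ Cθ³/(1 − κ)`; no printed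
line compares this with `εCKN` — recorded, no verdict implied.) CONSUMED binder. [claim: Schatz2025, status: disputed]
[cite: Schatz2025, Thm R.5 proof p.54 l.11–12] -/
def Step_R5a : Prop :=
  ∀ θ κ C β C' ε : ℝ, 0 < θ → θ < 1 / 8 → 0 < κ → κ < 1 → 0 ≤ C → ContractsWith θ κ C →
    0 < β → β < 1 → 0 ≤ C' → RHTWith β C' → 0 < ε → EpsRegWith ε → CoveredBySmall ε

/-- **Lemma Q.1 (Vitali covering) p.50 l.3–14 + Thm R.5 l.12–13 «A Vitali subcover gives smoothness on the entire
slab», AS USED**: if every point of the open slab lies in an open cylinder inside the slab on which `u` is a.e.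
smooth, then `u` is a.e. equal on the slab to a function jointly `C^∞` on `(0,T) × ℝ³`. TRUE-type (gluing of
local smooth representatives); CONSUMED binder. [claim: Schatz2025, status: disputed]
[cite: Schatz2025, Lemma Q.1 p.50 l.3–14; Thm R.5 p.54 l.12–13] -/
def Step_Q : Prop :=
  ∀ (T : ℝ) (u : ℝ → E3 → E3), 0 < T →
    (∀ z ∈ (slabT T : Set (ℝ × E3)), ∃ (z' : ℝ × E3) (r : ℝ), 0 < r ∧ z ∈ parabolicCylinder r z' ∧
        parabolicCylinder r z' ⊆ (slabT T : Set (ℝ × E3)) ∧ SmoothOnCyl u r z') →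
      ∃ w : ℝ → E3 → E3, (∀ᵐ z ∂(volume.restrict (slabT T : Set (ℝ × E3))), w z.1 z.2 = u z.1 z.2) ∧
        IsSmoothSpaceTimeOn (Ioo 0 T) w

/-- **Thm R.5, uniqueness paragraph** p.54 l.14–20 («Weak–strong uniqueness. Let w = u − v. By Proposition R.4,
u ∈ L¹((τ, T]; W^{1,∞}). Testing the difference …»): uniqueness among Leray–Hopf solutions GIVEN the smoothness
face — typed as the implication the print asserts (RECORDED lane, hazard h2). [claim: Schatz2025, status: disputed]
[cite: Schatz2025, Thm R.5 p.54 l.14–20; Prop R.4 p.53 l.38] -/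
def Step_R5u : Prop := ClaimedTheorem → ClaimedUniqueness

/-! ### Records: Thm S.13 (AC2–TI) p.60 — locator only

Theorem S.13 p.60 l.1–19: «Let Iθ := (−θ², 0] and S_J[Iθ] := ∫_{Iθ} S_J(t) dt = ∫_{Iθ} Σ_{j≥J} 2^{2j} ‖∆_j u(t)‖²_{L²} dt.
There exist geometry–only constants θcap ∈ (0, 1), w0 ∈ N and C < ∞ such that for each θ ∈ (0, θ0] there is an
anchor index J(θ) with S_{J+w}[Iθ] ≤ θcap S_J[Iθ] + C θ³ for all w ≥ w0. (S.10)» — named on p.3 l.28–31 as the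
Stage-3 input of App. M but cited neither in Lemma M.1's proof (Remark M.3) nor in Thm R.5's; not typed (no
Littlewood–Paley blocks on `ℝ³` in the tree's vocabulary); the Stage-3 output is `Step_M4`. -/

/-! ### Kernel compositions (the paper's own implications; PROVED) -/

/-- Half cylinders sit inside whole ones (`Q_{r/2}(z) ⊆ Q_r(z)`, the cylinders of p.48 l.3 / CKN 1982 §2).
[cite: CaffarelliKohnNirenberg1982, §2 before (2.6)] -/
private theorem parabolicCylinder_half_subset {r : ℝ} (hr : 0 < r) (z : ℝ × E3) :
    parabolicCylinder (r / 2) z ⊆ parabolicCylinder r z := by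
  refine prod_mono (Ioo_subset_Ioo (by nlinarith) le_rfl) (ball_subset_ball (by linarith))

/-- The p.42 LOCAL face implies the p.3 face (restrict to the slab; drop `r ≤ 1`). [cite: Schatz2025, (M.1) p.42 l.36–38; p.3 l.40–42] -/
theorem step_M1_of_local (h : Step_M1_local) : Step_M1 := by
  obtain ⟨θ, κ, C, hθ, hθ8, hκ, hκ1, hC, hcon⟩ := h
  exact ⟨θ, κ, C, hθ, hθ8, hκ, hκ1, hC, fun T u₀ u p hsol z r hr =>
    hcon (slabT T) u p hsol.suitable z r hr.1 hr.2.2⟩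

/-- **Thm R.5 p.54 l.11–13 as composed**: (Gε) + RHT + the smallness entrance + ε-regularity + Vitali/gluing ⇒
Theorem 2.1 (regularity face). [cite: Schatz2025, Thm R.5 proof p.54 l.11–13; p.3 l.18–39] -/
theorem claim_of_steps (hM1 : Step_M1) (hN1 : Step_N1) (hR5 : Step_R5a) (hP1 : Step_P1) (hQ : Step_Q) :
    ClaimedTheorem := by
  intro T hT u₀ u p hsol
  obtain ⟨θ, κ, C, hθ, hθ8, hκ, hκ1, hC, hcon⟩ := hM1
  obtain ⟨β, C', hβ, hβ1, hC', hrht⟩ := hN1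
  obtain ⟨ε, hε, hreg⟩ := hP1
  have hcov : CoveredBySmall ε := hR5 θ κ C β C' ε hθ hθ8 hκ hκ1 hC hcon hβ hβ1 hC' hrht hε hreg
  refine hQ T u hT fun z hz => ?_
  obtain ⟨z', r, hr, hzr, hsub, hF⟩ := hcov T u₀ u p hsol z hz
  exact ⟨z', r / 2, by positivity, hzr, (parabolicCylinder_half_subset hr z').trans hsub,
    hreg T u₀ u p hsol z' r hr hsub hF⟩

/-- **The fine composition through App. M's own input**: (M.4) + App. M Steps 4–7 + RHT + smallness entrance +
ε-regularity + Vitali ⇒ Theorem 2.1 (regularity face). [cite: Schatz2025, App. M p.42–43; Thm R.5 p.54 l.11–13] -/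
theorem claim_of_steps_fine (hM4 : Step_M4) (hMb : Step_Mbook) (hN1 : Step_N1) (hR5 : Step_R5a)
    (hP1 : Step_P1) (hQ : Step_Q) : ClaimedTheorem :=
  claim_of_steps (hMb hM4) hN1 hR5 hP1 hQ

/-- The uniqueness face from the whole printed chain (Thm R.5 p.54 l.14–20 on top of the regularity chain).
[cite: Schatz2025, Thm R.5 p.54 l.1–20] -/
theorem uniqueness_of_steps (hu : Step_R5u) (hM1 : Step_M1) (hN1 : Step_N1) (hR5 : Step_R5a)
    (hP1 : Step_P1) (hQ : Step_Q) : ClaimedUniqueness :=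
  hu (claim_of_steps hM1 hN1 hR5 hP1 hQ)

/-! ### Clay (A) link — PROVED (tree doors; no bridge hypothesis) -/

/-- **Fefferman (A) at `ν = 1` from the regularity face of Theorem 2.1**: a Clay datum is `L²` and weakly
divergence free; Leray's weak solution with its Riesz pressure is a global Leray–Hopf solution that is a local
energy (hence CKN-suitable) solution on every slab (tree, CKN 1982 Appendix); `ClaimedTheorem` makes it smooth on
`(0, T+1) × ℝ³`, hence essentially bounded on a parabolic cylinder below every `(T, x)`, `T > 0`; the tree door
`clay_solution_of_locallyBounded_globalLerayHopf` supplies the Clay solution on `[0, ∞)` with (6)–(7).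
[cite: FeffermanClay2006, (A) with (4) (6) (7) p. 2] [cite: Schatz2025, Thm 2.1 p.3 l.2–9]
[cite: CaffarelliKohnNirenberg1982, Appendix] -/
theorem clayA_at_one_of_claimed (h : ClaimedTheorem) : ClayVariants.clayR3.RegularityAt 1 := by
  intro u₀ hu₀ hdiv hdec
  -- the datum is `L²` and weakly divergence free
  have hL2 : ∫⁻ x, ‖u₀ x‖ₑ ^ 2 < ⊤ := by
    refine lt_of_le_of_lt (le_of_eq (lintegral_congr fun x => ?_))
      (hdec.lintegral_enorm_iteratedFDeriv_sq_lt_top 0)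
    rw [← ofReal_norm, ← ofReal_norm, norm_iteratedFDeriv_zero]
  have hu2 : MemLp u₀ 2 volume :=
    ⟨hu₀.continuous.aestronglyMeasurable, eLpNorm_two_lt_top_of_lintegral_enorm_sq_lt_top hL2⟩
  have hwdiv : IsWeaklyDivFree u₀ :=
    VectorCalculus.IsDivFree.isWeaklyDivFree_holds (fun x => hdiv x) (hu₀.of_le (mod_cast le_top))
  -- Leray's weak solution with its Riesz-transform pressure: global Leray–Hopf and suitable on every slab
  obtain ⟨v, p, hLH, -, -, -, -, -, hLE⟩ :=
    exists_isGlobalLerayHopf_and_isLocalEnergySolutionOn one_pos hu2 hwdiv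
  have hbd : ∀ T : ℝ, 0 < T → ∀ x : E3, ∃ r : ℝ, 0 < r ∧
      eLpNorm (uncurry v) ⊤ (volume.restrict (parabolicCylinder r ((T : ℝ), x))) < ⊤ := by
    intro T hT x
    have hsol : IsSolution (T + 1) u₀ v p :=
      ⟨hu2, hwdiv, hLH (T + 1) (by linarith), (hLE (T + 1) (by linarith)).suitable⟩
    obtain ⟨w, hwv, hw⟩ := h (T + 1) (by linarith) u₀ v p hsol
    -- a radius with `r² < T`, so that the closed cylinder stays inside the open slab
    obtain ⟨r, hr, hrT⟩ : ∃ r : ℝ, 0 < r ∧ r ^ 2 < T := by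
      refine ⟨min 1 (T / 2) / 1, by positivity, ?_⟩
      have h1 : min 1 (T / 2) ≤ 1 := min_le_left _ _
      have h2 : min 1 (T / 2) ≤ T / 2 := min_le_right _ _
      have h3 : 0 < min 1 (T / 2) := by positivity
      nlinarith
    refine ⟨r, hr, ?_⟩
    -- the compact closure `K = [T − r², T] × B̄_r(x)` of the cylinder, inside `(0, T+1) × ℝ³`
    set K : Set (ℝ × E3) := Icc (T - r ^ 2) T ×ˢ closedBall x r with hK
    have hKc : IsCompact K := isCompact_Icc.prod (isCompact_closedBall _ _)
    have hKsub : K ⊆ Ioo 0 (T + 1) ×ˢ (univ : Set E3) := by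
      rintro ⟨t, y⟩ ⟨ht, -⟩
      exact ⟨⟨by linarith [ht.1], by linarith [ht.2]⟩, mem_univ _⟩
    have hQK : parabolicCylinder r ((T : ℝ), x) ⊆ K := by
      rintro ⟨t, y⟩ hz
      simp only [parabolicCylinder, mem_prod, mem_Ioo, mem_ball] at hz
      exact ⟨⟨hz.1.1.le, hz.1.2.le⟩, mem_closedBall.2 hz.2.le⟩
    -- the smooth version `w` is bounded on `K`
    have hwc : ContinuousOn (uncurry w) K := (hw.continuousOn).mono hKsub
    obtain ⟨M, hM⟩ := hKc.exists_bound_of_continuousOn hwc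
    -- `v = w` a.e. on the cylinder
    have hQmeas : MeasurableSet (parabolicCylinder r ((T : ℝ), x)) :=
      (isOpen_parabolicCylinder r _).measurableSet
    have hslab : (slabT (T + 1) : Set (ℝ × E3)) = Ioo 0 (T + 1) ×ˢ (univ : Set E3) := rfl
    have hae : ∀ᵐ z ∂(volume.restrict (parabolicCylinder r ((T : ℝ), x))), uncurry v z = uncurry w z := by
      have h1 : ∀ᵐ z ∂(volume.restrict (slabT (T + 1) : Set (ℝ × E3))), uncurry v z = uncurry w z :=
        hwv.mono fun z hz => hz.symm
      rw [hslab] at h1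
      exact ae_restrict_of_ae_restrict_of_subset (hQK.trans hKsub) h1
    have hbdd : ∀ᵐ z ∂(volume.restrict (parabolicCylinder r ((T : ℝ), x))), ‖uncurry v z‖ ≤ M := by
      filter_upwards [hae, ae_restrict_mem hQmeas] with z hz hzQ
      rw [hz]; exact hM z (hQK hzQ)
    exact lt_of_le_of_lt (eLpNorm_le_of_ae_bound hbdd) (by simp)
  obtain ⟨U, P, hU, hP, hns, hE⟩ := clay_solution_of_locallyBounded_globalLerayHopf one_pos hu₀ hdiv hdec hLH hbd
  exact ⟨U, P, hU, hP, hns, hE⟩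

/-- **Fefferman (A) (all viscosities) from the regularity face of Theorem 2.1** (`ν = 1` is the print's
normalisation p.1 l.26; the tree's scaling `clayR3_regularityAt_iff` undoes it). No bridge hypothesis.
[cite: FeffermanClay2006, (A) p. 2] [cite: Schatz2025, Thm 2.1 p.3 l.2–9] -/
theorem clayA_of_claimed (h : ClaimedTheorem) : ClayVariants.clayR3.Regularity :=
  (ClayVariants.clayR3_regularityAt_iff one_pos).1 (clayA_at_one_of_claimed h)

/-- **Fefferman (A) from the whole printed chain.** [cite: FeffermanClay2006, (A) p. 2] [cite: Schatz2025, Thm 2.1; Thm R.5 p.54] -/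
theorem clayA_of_steps (hM1 : Step_M1) (hN1 : Step_N1) (hR5 : Step_R5a) (hP1 : Step_P1) (hQ : Step_Q) :
    ClayVariants.clayR3.Regularity :=
  clayA_of_claimed (claim_of_steps hM1 hN1 hR5 hP1 hQ)

end Literature.Claims.NS.Schatz2025

end

-- WHAT THIS IS NOT: not a claim about NS regularity or blow-up; not a claim about any author beyond the typed locator.
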